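import Mathlib.Order.PiLex
import Literature.Computability.Complexity.SymmetricThresholdPrograms
import HarnessLib

/-!
# Symmetric threshold programs: lexicographic comparison of wire vectors

A reusable GADGET for symmetric threshold programs (`SymProg`, `SymmetricThresholdPrograms.lean`):
for "owners" `k : K` carrying Boolean vectors of wires `b k : Fin J → _` (a window vertex and its
adjacency row towards the ORDERED part; a label and its replayed instance data; two candidate
codes), the gates comparing two owners' vectors for equality and in the strict lexicographic
order.  This is the initial colouring of the window by the ordered part, and the comparison step
of certification, in the window canoniser of route `PneNP/SymmetryBudget` (item `NoHiddenOrder`).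

* `VecCmp.sem_less` — `less k k'` carries `toLex (B k) < toLex (B k')`;
* `VecCmp.sem_eqall` — `eqall k k'` carries `B k = B k'`;
* `VecCmp.rankIn_lt_iff`, `VecCmp.rankIn_eq_iff` — hence `less`/`eqall` read the order and kernel
  of the colouring `k ↦ #{k' ∈ S | B k' <lex B k}` (competition rank), the form the refinement
  gadget consumes.
Gate count `O(|K|²·J)`.

## References
* M. Anderson, A. Dawar, *On symmetric circuits and fixed-point logics*, Theory Comput. Syst. 60
  (2017), §3 [AndersonDawar2016].
-/

namespace Literature.Computability.Complexity

open Finset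

namespace SymProg

variable {ι Λ : Type*} [DecidableEq ι] [DecidableEq Λ] (P : SymProg ι Λ) (K : Type*) (J : ℕ)

/-- **The vector-comparison gadget** inside `P` for owners `K` and vectors of length `J`.
[cite: AndersonDawar2016, §3] -/
structure VecCmp where
  /-- the bit wires of an owner -/
  b : K → Fin J → ι ⊕ Λ
  /-- `both k k' j`: both bits at `j` are true -/
  both : K → K → Fin J → Λ
  /-- `none k k' j`: both bits at `j` are false -/
  none : K → K → Fin J → Λ
  /-- `eqv k k' j`: the bits at `j` agree -/
  eqv : K → K → Fin J → Λ
  /-- `nb k j`: the bit of `k` at `j` is false -/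
  nb : K → Fin J → Λ
  /-- `lt k k' j`: agreement below `j`, and at `j` the bit of `k` is false, of `k'` true -/
  lt : K → K → Fin J → Λ
  /-- OUTPUT `less k k'`: the vector of `k` is lexicographically smaller -/
  less : K → K → Λ
  /-- OUTPUT `eqall k k'`: the vectors agree -/
  eqall : K → K → Λ
  kind_both : ∀ k k' j, P.kind (both k k' j) = Kind.and
  srcs_both : ∀ k k' j, P.srcs (both k k' j) = {b k j, b k' j}
  kind_none : ∀ k k' j, P.kind (none k k' j) = Kind.nor
  srcs_none : ∀ k k' j, P.srcs (none k k' j) = {b k j, b k' j}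
  kind_eqv : ∀ k k' j, P.kind (eqv k k' j) = Kind.or
  srcs_eqv : ∀ k k' j, P.srcs (eqv k k' j) = {Sum.inr (both k k' j), Sum.inr (none k k' j)}
  kind_nb : ∀ k j, P.kind (nb k j) = Kind.nor
  srcs_nb : ∀ k j, P.srcs (nb k j) = {b k j}
  kind_lt : ∀ k k' j, P.kind (lt k k' j) = Kind.and
  srcs_lt : ∀ k k' j, P.srcs (lt k k' j) =
    (univ.filter fun q => q < j).image (fun q => Sum.inr (eqv k k' q)) ∪ {Sum.inr (nb k j), b k' j}
  kind_less : ∀ k k', P.kind (less k k') = Kind.or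
  srcs_less : ∀ k k', P.srcs (less k k') = univ.image fun j => Sum.inr (lt k k' j)
  kind_eqall : ∀ k k', P.kind (eqall k k') = Kind.and
  srcs_eqall : ∀ k k', P.srcs (eqall k k') = univ.image fun j => Sum.inr (eqv k k' j)

namespace VecCmp

variable {P K J} (C : P.VecCmp K J) (x : ι → Bool)

/-- The Boolean vector of an owner on input `x`. [folklore] -/
def B (k : K) : Fin J → Bool := fun j => wval x (P.sem x) (C.b k j)

/-- Strict lexicographic comparison of vectors, unfolded. [folklore] -/
theorem toLex_lt_toLex_iff (a a' : Fin J → Bool) :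
    toLex a < toLex a' ↔ ∃ i, (∀ j, j < i → a j = a' j) ∧ a i < a' i := Iff.rfl

/-- `eqv`: the bits at `j` agree. [folklore] -/
theorem sem_eqv (k k' : K) (j : Fin J) : P.sem x (C.eqv k k' j) = true ↔ C.B x k j = C.B x k' j := by
  rw [P.sem_or (C.kind_eqv k k' j), C.srcs_eqv]
  simp only [mem_insert, mem_singleton, exists_eq_or_imp, exists_eq_left, wval_inr]
  rw [P.sem_and (C.kind_both k k' j), C.srcs_both, P.sem_nor (C.kind_none k k' j), C.srcs_none]
  simp only [mem_insert, mem_singleton, forall_eq_or_imp, forall_eq]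
  change (C.B x k j = true ∧ C.B x k' j = true) ∨ (C.B x k j = false ∧ C.B x k' j = false) ↔ _
  cases C.B x k j <;> cases C.B x k' j <;> simp

/-- `nb`: the bit of `k` at `j` is false. [folklore] -/
theorem sem_nb (k : K) (j : Fin J) : P.sem x (C.nb k j) = true ↔ C.B x k j = false := by
  rw [P.sem_nor (C.kind_nb k j), C.srcs_nb]
  simp only [mem_singleton, forall_eq]
  rfl

/-- `lt k k' j`: agreement below `j`, `false < true` at `j`. [folklore] -/
theorem sem_lt (k k' : K) (j : Fin J) :
    P.sem x (C.lt k k' j) = true ↔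
      (∀ q, q < j → C.B x k q = C.B x k' q) ∧ C.B x k j = false ∧ C.B x k' j = true := by
  rw [P.sem_and (C.kind_lt k k' j), C.srcs_lt]
  simp only [mem_union, mem_image, mem_filter, mem_univ, true_and, mem_insert, mem_singleton]
  constructor
  · intro h
    refine ⟨fun q hq => ?_, ?_, ?_⟩
    · have := h _ (Or.inl ⟨q, hq, rfl⟩)
      rwa [wval_inr, sem_eqv] at this
    · have := h _ (Or.inr (Or.inl rfl))
      rwa [wval_inr, sem_nb] at this
    · exact h _ (Or.inr (Or.inr rfl))
  · rintro ⟨h1, h2, h3⟩ w (⟨q, hq, rfl⟩ | rfl | rfl)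
    · rw [wval_inr, sem_eqv]; exact h1 q hq
    · rw [wval_inr, sem_nb]; exact h2
    · exact h3

/-- **`less k k'`: the vector of `k` is lexicographically smaller.** [folklore] -/
theorem sem_less (k k' : K) : P.sem x (C.less k k') = true ↔ toLex (C.B x k) < toLex (C.B x k') := by
  rw [P.sem_or (C.kind_less k k'), C.srcs_less, toLex_lt_toLex_iff]
  simp only [mem_image, mem_univ, true_and, exists_exists_eq_and, wval_inr, sem_lt, Bool.lt_iff]

/-- **`eqall k k'`: the vectors agree.** [folklore] -/
theorem sem_eqall (k k' : K) : P.sem x (C.eqall k k') = true ↔ C.B x k = C.B x k' := by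
  rw [P.sem_and (C.kind_eqall k k'), C.srcs_eqall]
  simp only [mem_image, mem_univ, true_and, forall_exists_index, forall_apply_eq_imp_iff, wval_inr,
    sem_eqv, funext_iff]

/-- The competition rank of an owner's vector among a finite set of owners. [folklore] -/
noncomputable def rankIn [DecidableEq K] (S : Finset K) (k : K) : ℕ := (S.filter fun k' => toLex (C.B x k') < toLex (C.B x k)).card

/-- Ranks within `S` are ordered as the vectors. [folklore] -/
theorem rankIn_lt_iff [DecidableEq K] {S : Finset K} {k : K} (hk : k ∈ S) (k' : K) :
    C.rankIn x S k < C.rankIn x S k' ↔ toLex (C.B x k) < toLex (C.B x k') := by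
  unfold rankIn
  constructor
  · intro h
    by_contra hle
    rw [not_lt] at hle
    refine absurd h (not_lt.2 (Finset.card_le_card fun m hm => ?_))
    rw [mem_filter] at hm ⊢
    exact ⟨hm.1, lt_of_lt_of_le hm.2 hle⟩
  · intro h
    apply Finset.card_lt_card
    refine Finset.ssubset_iff_subset_ne.2 ⟨fun m hm => ?_, fun heq => ?_⟩
    · rw [mem_filter] at hm ⊢
      exact ⟨hm.1, hm.2.trans h⟩
    · have : k ∈ S.filter fun m => toLex (C.B x m) < toLex (C.B x k') := mem_filter.2 ⟨hk, h⟩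
      rw [← heq, mem_filter] at this
      exact lt_irrefl _ this.2

/-- Ranks within `S` are equal iff the vectors are. [folklore] -/
theorem rankIn_eq_iff [DecidableEq K] {S : Finset K} {k k' : K} (hk : k ∈ S) (hk' : k' ∈ S) :
    C.rankIn x S k = C.rankIn x S k' ↔ C.B x k = C.B x k' := by
  constructor
  · intro h
    rcases lt_trichotomy (toLex (C.B x k)) (toLex (C.B x k')) with h' | h' | h'
    · exact absurd h ((C.rankIn_lt_iff x hk k').2 h').ne
    · exact toLex.injective h'
    · exact absurd h ((C.rankIn_lt_iff x hk' k).2 h').ne'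
  · intro h
    unfold rankIn
    rw [h]

end VecCmp

end SymProg

end Literature.Computability.Complexity
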